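import Literature.Probability.LatticeModels.CollarLegModelConfigs
import Summits.CriticalPhenomena.CardyFormulaZ2.Theorems.CardyBoundaryCoulombGasBoundaryDefectGaussianRStubRealisabilityPart7
import Summits.CriticalPhenomena.CardyFormulaZ2.Theorems.CardyBoundaryCoulombGasBoundaryDefectGaussianRStubRealisabilityPart8

/-!
# Stub `stub_realisability` of line `rainbow-monomials-in-excursion-kernels` — Part 13:
# the consistency of FROZEN turns does not depend on the height configuration (Lemma C of D2)
# (crux `BoundaryDefectGaussianR`, stmt-CriticalPhenomena-14132; insertion dictionary D2)

In the weight of a height configuration `h` of a `CollarLegModel` `M`, a frozen medial vertex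
(`e ∈ M.frozenEdges`) contributes the turn factors `openFactor` (for `e ∈ M.openEdges`: spokes,
ghost edges, outer-corner edges of pockets) or `closedFactor` (every other frozen edge). Each factor
is a phase when the tracked turn is CONSISTENT and `1` otherwise, the consistency conditions being
`M.hv h e.1 = M.hv h (edgeTip e)` (open) and `M.hf h (leftFace e true) = M.hf h (leftFace e false)`
(closed). Lemma C of the lead's roadmap for the insertion dictionary D2 says that for the jump
collar `M = ι.model V` of an admissible leg insertion these conditions do NOT depend on `h`, so
that the set `B₀` of cut corners is a datum of `(ι, V)` alone. This file proves it in the form: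

* (C-open) `openEdges_endpoints_not_free`, `openEdges_hv_eq` — for ANY collar leg model, both
  endpoints of a frozen open edge are prescribed vertex-cells (an arc vertex and a ghost, or two
  ghosts): `hv h` there is `C.vertH`, for every `h`;
* (C-closed) `closed_leftFace_not_free`, `closed_hf_eq` — for `M = ι.model V` with `ι` ADMISSIBLE
  on a `V` WITHOUT DIAGONAL PINCHES (no unit square meets `V` in exactly two diagonal corners), a
  frozen edge that is not open has NO free side face: each of its two side faces is either not a
  cell or a prescribed collar face, so `hf h` there is `C.faceH`, for every `h` (consistent iff the
  two collar levels agree: an ordinary exterior edge; inconsistent iff they differ: a JUMP EDGE, a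
  permanent cut).
The heart of (C-closed) is `pocketCorner_mem_arc`: a corner of a pocket lying in `V` and
lattice-adjacent to a corner outside `V` is a Dirichlet-arc vertex (the pocket is the gap face of a
dart `(u, k)` followed by a wired stretch; its corners are `u`, the ghost `u + dir k`,
`a = u + dir (k+1)` and `b = u + dir k + dir (k+1)`; `a ∈ V, b ∉ V` makes `(a, k)` the next dart,
`a, b ∈ V` makes `(b, k+3)` the next dart — both on the wired stretch, also across the seam of the
closed walk by admissibility — and `a ∉ V, b ∈ V` is a diagonal pinch). Hence every edge of a
pocket is live, a spoke or a ghost edge, never a closed frozen edge; and an interior face has its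
four corners in `V`, so its edges are live.

Registered sub-goal carried here: `s13_frozenConsistency` (one-line form at the end).

## Why the no-pinch hypothesis, and what is NOT claimed (exact evaluation, `#eval`, this seat)

* Unit tests (brief): on the `4×2` and `6×2` boxes and the L-shape `[0,5]×[0,1] ∪ [0,1]×[2,4]`
  with the data `(2;2)`, `(1;1)` (short and long wired arc), `(1,1;2)`, `(1,1,1;3)` (14 admissible
  placements, 0 – 47 open edges and 16 – 31 closed frozen edges each): no closed frozen edge has a
  free side face, and the two endpoints of every open edge carry the same `vertH`.
* The no-pinch hypothesis cannot be dropped, even for `V` lattice-connected with king-connected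
  complement and insertion points flat at radius `sinkLegs + 3`: `V = [0,30]×[0,20] ∖ ([8,20]×[6,12]
  ∪ {21}×[13,20])` (a chamber joined to the outside through the diagonal pinch `(20,12)–(21,13)` and
  a notch), `(1;1)` with source `(26,20)`, sink `(14,5)` is admissible and flat at radius `4`; the
  pinch square `(20,12)` is a POCKET whose corner `(20,13) ∈ V` is met by the walk on the FREE
  stretch only (not an arc vertex), so the exterior edge `((20,13), E)` is a closed frozen edge at the
  vertex-cell `(20,13)` whose two side faces are cells, the lower one being the (free) pocket.
* NOT claimed here: that the two prescribed endpoint levels of an open edge AGREE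
  (`vertH e.1 = vertH (edgeTip e)`, i.e. open edges are never cuts). This needs a local-chart
  hypothesis on `V` beyond no-pinch and connectivity (Part 34, `s13_openEdgeLevels`): with a
  complement fjord one diagonal step wide (`V = {v ∈ [0,47]×[0,24] : ¬(15 ≤ v.1 ≤ 31 ∧ 9 ≤ v.2 ≤ 14)
  ∧ ¬(15 ≤ v.2 ∧ (v.1 = v.2 + 15 ∨ v.1 = v.2 + 16))}`, data `(1,1,1;3)` with sources `(47,12), (24,8),
  (22,8)` of one leg each, sink `(23,0)`: admissible, pinch-free, flat at radius `6` at all four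
  points, `#eval`) the two fjord walls are wired at levels `-1` and `-3`, and the ghost edge
  `((30,15), E)` under the pocket `(30,15)` of the level-`-3` wall has `vertH (30,15) = -3`,
  `vertH (31,15) = -1`.
-/

namespace Summit.CriticalPhenomena.CardyFormulaZ2.Cruxes.BoundaryDefectGaussianR.RainbowMonomialsInExcursionKernels

open Literature.Probability.LatticeModels Literature.Probability.LatticeModels.CollarLegModel

/-! ### (C-open) the endpoints of a frozen open edge are prescribed -/

/-- **(C-open).** Both endpoints of a frozen OPEN edge of a collar leg model are prescribed
vertex-cells (not free): a spoke joins an arc vertex to a ghost, a pocket edge joins two points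
outside `V`. [folklore] -/
theorem openEdges_endpoints_not_free (M : CollarLegModel) {e : (ℤ × ℤ) × Bool}
    (he : e ∈ M.openEdges) :
    (e.1, false) ∉ M.freeCells ∧ (SixVertex.edgeTip e, false) ∉ M.freeCells := by
  simp only [openEdges, Finset.mem_filter] at he
  obtain ⟨-, h⟩ := he
  rw [mem_freeCells_false, mem_freeCells_false]
  simp only [freeVerts, Finset.mem_sdiff, not_and, not_not]
  have hg : ∀ x, x ∈ M.ghosts → x ∉ M.V := fun x hx => (Finset.mem_sdiff.1 hx).2
  have ha : ∀ x, x ∈ M.arcVerts → x ∈ M.C.arc := fun x hx => (Finset.mem_inter.1 hx).1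
  rcases h with ⟨h1, h2⟩ | ⟨h1, h2⟩ | ⟨h1, h2, -⟩
  · exact ⟨fun _ => ha _ h1, fun hV => absurd hV (hg _ h2)⟩
  · exact ⟨fun hV => absurd hV (hg _ h2), fun _ => ha _ h1⟩
  · exact ⟨fun hV => absurd hV h1, fun hV => absurd hV h2⟩

/-- **(C-open), height form.** At a frozen open edge the two endpoint heights are the prescribed
ones in EVERY configuration; in particular the consistency condition of `openFactor`,
`hv h e.1 = hv h (edgeTip e)`, does not depend on `h`. [folklore] -/
theorem openEdges_hv_eq (M : CollarLegModel) {e : (ℤ × ℤ) × Bool} (he : e ∈ M.openEdges)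
    (h : ↥M.freeCells → ℤ) :
    M.hv h e.1 = M.C.vertH e.1 ∧ M.hv h (SixVertex.edgeTip e) = M.C.vertH (SixVertex.edgeTip e) :=
  ⟨hv_of_not_mem M h (openEdges_endpoints_not_free M he).1,
    hv_of_not_mem M h (openEdges_endpoints_not_free M he).2⟩

/-! ### Lattice bookkeeping: side faces, face corners, gap faces, pinches -/

/-- The two endpoints of a lattice edge are corners of each of its side faces, and the edge is one
of the four edges of that face. [folklore] -/
theorem endpoints_mem_faceCorners_leftFace (e : (ℤ × ℤ) × Bool) (s : Bool) :
    e.1 ∈ SixVertex.faceCorners (SixVertex.leftFace e s) ∧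
    SixVertex.edgeTip e ∈ SixVertex.faceCorners (SixVertex.leftFace e s) ∧
    e ∈ faceEdges (SixVertex.leftFace e s) := by
  obtain ⟨⟨x, y⟩, b⟩ := e
  cases b <;> cases s <;>
    simp [SixVertex.leftFace, SixVertex.faceCorners, SixVertex.edgeTip, faceEdges]

/-- The far endpoint of an edge is one unit east or one unit north of its base point. [folklore] -/
theorem edgeTip_eq_or (e : (ℤ × ℤ) × Bool) :
    SixVertex.edgeTip e = (e.1.1 + 1, e.1.2) ∨ SixVertex.edgeTip e = (e.1.1, e.1.2 + 1) := by
  unfold SixVertex.edgeTip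
  split_ifs <;> simp

/-- The four corners of the gap face of the dart `(u, k)`: `u`, its tip `u + dir k`,
`u + dir (k+1)` and the diagonal corner `u + dir k + dir (k+1)`. [folklore] -/
theorem mem_faceCorners_gapFace (u x : ℤ × ℤ) (k : Fin 4) :
    x ∈ SixVertex.faceCorners (gapFace (u, k)) ↔
      x = u ∨ x = u + dir k ∨ x = u + dir (k + 1) ∨ x = u + dir k + dir (k + 1) := by
  obtain ⟨a, b⟩ := u
  obtain ⟨x₁, x₂⟩ := x
  fin_cases k <;> simp [gapFace, SixVertex.faceCorners, dir, Prod.ext_iff] <;> omega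

/-- The tip `u + dir k` and the corner `u + dir (k+1)` of a gap face are diagonal to each other,
not lattice neighbours. [folklore] -/
theorem not_adjacent_dir_succ_dir (u p q : ℤ × ℤ) (k : Fin 4) (hp : p = u + dir (k + 1))
    (hq : q = u + dir k) :
    ¬ ((q.1 = p.1 + 1 ∧ q.2 = p.2) ∨ (q.1 = p.1 ∧ q.2 = p.2 + 1) ∨ (p.1 = q.1 + 1 ∧ p.2 = q.2) ∨
      (p.1 = q.1 ∧ p.2 = q.2 + 1)) := by
  have key : ∀ k : Fin 4, ¬ (((dir k).1 = (dir (k + 1)).1 + 1 ∧ (dir k).2 = (dir (k + 1)).2) ∨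
      ((dir k).1 = (dir (k + 1)).1 ∧ (dir k).2 = (dir (k + 1)).2 + 1) ∨
      ((dir (k + 1)).1 = (dir k).1 + 1 ∧ (dir (k + 1)).2 = (dir k).2) ∨
      ((dir (k + 1)).1 = (dir k).1 ∧ (dir (k + 1)).2 = (dir k).2 + 1)) := by decide
  have := key k
  subst hp hq
  simp only [Prod.fst_add, Prod.snd_add]
  omega

/-- **No diagonal pinch, dart form.** If no unit square meets `V` in exactly two diagonal corners,
then a vertex `u ∈ V` whose diagonal neighbour `u + dir k + dir (k+1)` lies in `V` has `u + dir k`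
or `u + dir (k+1)` in `V`. [folklore] -/
theorem noPinch_dir {V : Finset (ℤ × ℤ)}
    (hnp : ∀ x y : ℤ, ((x, y) ∈ V → (x + 1, y + 1) ∈ V → (x + 1, y) ∈ V ∨ (x, y + 1) ∈ V) ∧
      ((x + 1, y) ∈ V → (x, y + 1) ∈ V → (x, y) ∈ V ∨ (x + 1, y + 1) ∈ V))
    {u : ℤ × ℤ} {k : Fin 4} (hu : u ∈ V) (hb : u + dir k + dir (k + 1) ∈ V) :
    u + dir k ∈ V ∨ u + dir (k + 1) ∈ V := by
  obtain ⟨a, b⟩ := u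
  fin_cases k <;> simp [dir] at hb ⊢
  · exact (hnp a b).1 hu hb
  · have := (hnp (a - 1) b).2; simp only [sub_add_cancel] at this; exact (this hu hb).symm
  · have := (hnp (a - 1) (b - 1)).1; simp only [sub_add_cancel] at this; exact (this hb hu).symm
  · have := (hnp a (b - 1)).2; simp only [sub_add_cancel] at this; exact this hb hu

/-! ### The boundary cycle of an admissible datum: exterior darts, the next dart on a wired stretch -/

section Admissible

variable (ι : LegInsertionData) (V : Finset (ℤ × ℤ)) {d₀ : Dart} (hadm : ι.IsAdmissible V)
  (h : outDart V ι.sink = some d₀) {st : ℕ → WalkState}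
  (hst : ∀ t, st t = List.foldl (fun s d => s.step (ι.startAt V d)) ι.init ((cycle V d₀).take t))

include hadm h in
/-- Every dart of the boundary cycle of an admissible datum is an exterior dart: its vertex lies in
`V`, its tip does not. [folklore] -/
theorem cycle_getElem_exterior {t : ℕ} (ht : t < (cycle V d₀).length) :
    ((cycle V d₀)[t]).1 ∈ V ∧ ((cycle V d₀)[t]).1 + dir ((cycle V d₀)[t]).2 ∉ V := by
  obtain ⟨hv₀, ht₀⟩ := sinkDart_exterior ι V hadm h
  have hget : (cycle V d₀)[t] = (dsucc V)^[t] d₀ := by simp [cycle]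
  rw [hget]
  exact (s3_dsucc_iterate V t).1 d₀ hv₀ ht₀

include hadm h hst in
/-- **The next dart on a wired stretch.** If the stretch after dart `t` is wired, the
`dsucc`-successor of dart `t` is a dart `t'` of the cycle preceded by a wired stretch — `t' = t + 1`,
or, across the seam of the closed walk (`t + 1 = P`), `t' = 0`: by admissibility the walk closes up,
the final wiredness being the initial one. [folklore] -/
theorem exists_next_dart_wired {t : ℕ} (ht : t < (cycle V d₀).length)
    (hw : (st (t + 1)).wired = true) :
    ∃ (t' : ℕ) (_ : t' < (cycle V d₀).length),
      (cycle V d₀)[t'] = dsucc V (cycle V d₀)[t] ∧ (st t').wired = true := by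
  by_cases hlt : t + 1 < (cycle V d₀).length
  · refine ⟨t + 1, hlt, ?_, hw⟩
    simp only [cycle, List.getElem_iterate, Function.iterate_succ_apply']
  · have hP : t + 1 = (cycle V d₀).length := by omega
    obtain ⟨hv₀, ht₀⟩ := sinkDart_exterior ι V hadm h
    obtain ⟨-, -, hret, -⟩ := s3_period_spec V d₀ hv₀ ht₀
    have hlen : (cycle V d₀).length = period V d₀ := by simp [cycle]
    refine ⟨0, by omega, ?_, ?_⟩
    · have h0 : (cycle V d₀)[0] = d₀ := by simp [cycle]
      have htt : (cycle V d₀)[t] = (dsucc V)^[t] d₀ := by simp [cycle]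
      rw [h0, htt, show dsucc V ((dsucc V)^[t] d₀) = (dsucc V)^[t + 1] d₀ from
        (Function.iterate_succ_apply' (dsucc V) t d₀).symm, hP, hlen, hret]
    · obtain ⟨-, hwP, -⟩ := st_final ι V hadm h hst
      rw [← hP, hw] at hwP
      have h0 : st 0 = ι.init := by rw [hst]; rfl
      rw [h0]
      exact hwP.symm

include hadm h hst in
/-- **A corner of a pocket lying in `V` next to a corner outside `V` is an arc vertex.** For the
gap face of dart `t = (u, k)` followed by a wired stretch (a pocket of the jump collar) on a
pinch-free `V`: a corner `p ∈ V` of it that is a lattice neighbour of a corner `q ∉ V` of it is a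
Dirichlet-arc vertex — `p = u` is the vertex of dart `t`; `p = u + dir (k+1)` forces
`q = u + dir k + dir (k+1) ∉ V` and then `(p, k)` is the next dart; `p = u + dir k + dir (k+1)` with
`u + dir (k+1) ∈ V` makes `(p, k+3)` the next dart, and with `u + dir (k+1) ∉ V` is a pinch.
[folklore] -/
theorem pocketCorner_mem_arc
    (hnp : ∀ x y : ℤ, ((x, y) ∈ V → (x + 1, y + 1) ∈ V → (x + 1, y) ∈ V ∨ (x, y + 1) ∈ V) ∧
      ((x + 1, y) ∈ V → (x, y + 1) ∈ V → (x, y) ∈ V ∨ (x + 1, y + 1) ∈ V))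
    {t : ℕ} (ht : t < (cycle V d₀).length) (hw : (st (t + 1)).wired = true) {p q : ℤ × ℤ}
    (hp : p ∈ SixVertex.faceCorners (gapFace (cycle V d₀)[t])) (hpV : p ∈ V)
    (hq : q ∈ SixVertex.faceCorners (gapFace (cycle V d₀)[t])) (hqV : q ∉ V)
    (hadj : (q.1 = p.1 + 1 ∧ q.2 = p.2) ∨ (q.1 = p.1 ∧ q.2 = p.2 + 1) ∨ (p.1 = q.1 + 1 ∧ p.2 = q.2) ∨
      (p.1 = q.1 ∧ p.2 = q.2 + 1)) :
    p ∈ (ι.collar V).arc := by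
  have hext := cycle_getElem_exterior ι V hadm h ht
  rcases hdk : (cycle V d₀)[t] with ⟨u, k⟩
  rw [hdk] at hext hp hq
  simp only at hext
  rw [mem_faceCorners_gapFace] at hp hq
  rcases hp with rfl | rfl | rfl | rfl
  · -- `p = u`, the vertex of dart `t`
    exact (mem_collar_arc_iff ι V h hst).2 ⟨t, ht, Or.inr hw, by rw [hdk]⟩
  · -- `p = u + dir k`, the tip: not in `V`
    exact absurd hpV hext.2
  · -- `p = u + dir (k+1)`: then `q` is the diagonal corner, outside `V`, and `(p, k)` is next
    rcases hq with rfl | rfl | rfl | rfl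
    · exact absurd hext.1 hqV
    · exact absurd hadj (not_adjacent_dir_succ_dir u _ _ k rfl rfl)
    · exact absurd hpV hqV
    · have hqV' : u + dir (k + 1) + dir k ∉ V := by rwa [add_right_comm] at hqV
      have hds : dsucc V (u, k) = (u + dir (k + 1), k) := by simp [dsucc, hpV, hqV']
      obtain ⟨t', ht', hds', hw'⟩ := exists_next_dart_wired ι V hadm h hst ht hw
      exact (mem_collar_arc_iff ι V h hst).2 ⟨t', ht', Or.inl hw', by rw [hds', hdk, hds]⟩
  · -- `p = u + dir k + dir (k+1)`, the diagonal corner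
    by_cases haV : u + dir (k + 1) ∈ V
    · have hpV' : u + dir (k + 1) + dir k ∈ V := by rwa [add_right_comm] at hpV
      have hds : dsucc V (u, k) = (u + dir (k + 1) + dir k, k + 3) := by simp [dsucc, haV, hpV']
      obtain ⟨t', ht', hds', hw'⟩ := exists_next_dart_wired ι V hadm h hst ht hw
      exact (mem_collar_arc_iff ι V h hst).2
        ⟨t', ht', Or.inl hw', by rw [hds', hdk, hds, add_right_comm]⟩
    · rcases noPinch_dir hnp hext.1 hpV with hg | ha
      · exact absurd hg hext.2
      · exact absurd ha haV

end Admissible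

/-! ### (C-closed) a closed frozen edge has no free side face -/

/-- **(C-closed).** For an ADMISSIBLE leg insertion on a PINCH-FREE `V`, a frozen edge of the jump
collar that is not open has no free side face: neither side face is an interior face (its edges are
live) nor a pocket (its edges are live, spokes or ghost edges, by `pocketCorner_mem_arc`). So both
cells compared by `closedFactor` at such an edge are prescribed collar faces (or not cells at all).
[folklore] -/
theorem closed_leftFace_not_free (ι : LegInsertionData) (V : Finset (ℤ × ℤ))
    (hadm : ι.IsAdmissible V)
    (hnp : ∀ x y : ℤ, ((x, y) ∈ V → (x + 1, y + 1) ∈ V → (x + 1, y) ∈ V ∨ (x, y + 1) ∈ V) ∧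
      ((x + 1, y) ∈ V → (x, y + 1) ∈ V → (x, y) ∈ V ∨ (x + 1, y + 1) ∈ V))
    {e : (ℤ × ℤ) × Bool} (he : e ∈ (ι.model V).frozenEdges) (hne : e ∉ (ι.model V).openEdges)
    (s : Bool) : (SixVertex.leftFace e s, true) ∉ (ι.model V).freeCells := by
  intro hfree
  rw [mem_freeCells_true] at hfree
  obtain ⟨hc1, hc2, hfe⟩ := endpoints_mem_faceCorners_leftFace e s
  generalize SixVertex.leftFace e s = f at hfree hc1 hc2 hfe
  have hE : e ∉ (ι.model V).E := (Finset.mem_sdiff.1 he).2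
  have hnotboth : ¬ (e.1 ∈ V ∧ SixVertex.edgeTip e ∈ V) := fun hb =>
    hE (Finset.mem_filter.2 ⟨(SixVertex.mem_edges_iff V e).2 (Or.inl hb.1), hb⟩)
  rcases Finset.mem_union.1 hfree with hint | hpock
  · -- an interior face: all four corners in `V`, the edge is live
    have hsub : SixVertex.faceCorners f ⊆ V := (Finset.mem_filter.1 hint).2
    exact hnotboth ⟨hsub hc1, hsub hc2⟩
  · -- a pocket: the edge is live, a spoke or a ghost edge
    obtain ⟨d₀, h, -, -, -, -⟩ := s3_of_admissible ι V hadm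
    have hpC : f ∈ (ι.collar V).pocket := (Finset.mem_inter.1 hpock).1
    obtain ⟨t, ht, hw, hgap⟩ := (mem_collar_pocket_iff ι V h
      (st := fun t => List.foldl (fun s d => s.step (ι.startAt V d)) ι.init ((cycle V d₀).take t))
      (fun _ => rfl)).1 hpC
    subst hgap
    have hghost : ∀ x, x ∈ SixVertex.faceCorners (gapFace (cycle V d₀)[t]) → x ∉ V →
        x ∈ (ι.model V).ghosts := fun x hx hxV =>
      Finset.mem_sdiff.2 ⟨Finset.mem_union_right _ (Finset.mem_biUnion.2 ⟨_, hpock, hx⟩), hxV⟩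
    have harc : ∀ p q : ℤ × ℤ, p ∈ SixVertex.faceCorners (gapFace (cycle V d₀)[t]) → p ∈ V →
        q ∈ SixVertex.faceCorners (gapFace (cycle V d₀)[t]) → q ∉ V →
        ((q.1 = p.1 + 1 ∧ q.2 = p.2) ∨ (q.1 = p.1 ∧ q.2 = p.2 + 1) ∨ (p.1 = q.1 + 1 ∧ p.2 = q.2) ∨
          (p.1 = q.1 ∧ p.2 = q.2 + 1)) →
        p ∈ (ι.model V).arcVerts := fun p q hp hpV hq hqV hadj =>
      Finset.mem_inter.2 ⟨pocketCorner_mem_arc ι V hadm h (fun _ => rfl) hnp ht hw hp hpV hq hqV hadj,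
        hpV⟩
    have hadj : ((SixVertex.edgeTip e).1 = e.1.1 + 1 ∧ (SixVertex.edgeTip e).2 = e.1.2) ∨
        ((SixVertex.edgeTip e).1 = e.1.1 ∧ (SixVertex.edgeTip e).2 = e.1.2 + 1) := by
      rcases edgeTip_eq_or e with h1 | h1 <;> simp [h1]
    apply hne
    refine Finset.mem_filter.2 ⟨he, ?_⟩
    show (e.1 ∈ (ι.model V).arcVerts ∧ SixVertex.edgeTip e ∈ (ι.model V).ghosts) ∨
      (SixVertex.edgeTip e ∈ (ι.model V).arcVerts ∧ e.1 ∈ (ι.model V).ghosts) ∨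
      (e.1 ∉ V ∧ SixVertex.edgeTip e ∉ V ∧ ∃ p ∈ (ι.model V).pockets, e ∈ faceEdges p)
    by_cases h1 : e.1 ∈ V <;> by_cases h2 : SixVertex.edgeTip e ∈ V
    · exact absurd ⟨h1, h2⟩ hnotboth
    · exact Or.inl ⟨harc _ _ hc1 h1 hc2 h2 (hadj.elim Or.inl fun h' => Or.inr (Or.inl h')),
        hghost _ hc2 h2⟩
    · exact Or.inr (Or.inl ⟨harc _ _ hc2 h2 hc1 h1
        (hadj.elim (fun h' => Or.inr (Or.inr (Or.inl h'))) fun h' => Or.inr (Or.inr (Or.inr h'))),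
        hghost _ hc1 h1⟩)
    · exact Or.inr (Or.inr ⟨h1, h2, _, hpock, hfe⟩)

/-- **(C-closed), height form.** Under the same hypotheses the two side-face heights read by
`closedFactor` at a closed frozen edge are the prescribed collar levels in EVERY configuration; in
particular its consistency condition `hf h (leftFace e true) = hf h (leftFace e false)` does not
depend on `h` (it holds iff the two collar levels agree; at a jump edge they differ by `2`).
[folklore] -/
theorem closed_hf_eq (ι : LegInsertionData) (V : Finset (ℤ × ℤ)) (hadm : ι.IsAdmissible V)
    (hnp : ∀ x y : ℤ, ((x, y) ∈ V → (x + 1, y + 1) ∈ V → (x + 1, y) ∈ V ∨ (x, y + 1) ∈ V) ∧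
      ((x + 1, y) ∈ V → (x, y + 1) ∈ V → (x, y) ∈ V ∨ (x + 1, y + 1) ∈ V))
    {e : (ℤ × ℤ) × Bool} (he : e ∈ (ι.model V).frozenEdges) (hne : e ∉ (ι.model V).openEdges)
    (s : Bool) (hh : ↥(ι.model V).freeCells → ℤ) :
    (ι.model V).hf hh (SixVertex.leftFace e s) = (ι.model V).C.faceH (SixVertex.leftFace e s) :=
  hf_of_not_mem _ hh (closed_leftFace_not_free ι V hadm hnp he hne s)

/-- The consistency condition of `openFactor` at a frozen open edge, read on the collar data
(configuration-free form). [folklore] -/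
theorem openEdges_consistent_iff (M : CollarLegModel) {e : (ℤ × ℤ) × Bool} (he : e ∈ M.openEdges)
    (h : ↥M.freeCells → ℤ) :
    M.hv h e.1 = M.hv h (SixVertex.edgeTip e) ↔
      M.C.vertH e.1 = M.C.vertH (SixVertex.edgeTip e) := by
  rw [(openEdges_hv_eq M he h).1, (openEdges_hv_eq M he h).2]

/-- The consistency condition of `closedFactor` at a closed frozen edge of the jump collar of an
admissible insertion on a pinch-free `V`, read on the collar data (configuration-free form: the
edge is a permanent cut iff its two collar levels differ, i.e. iff it is a jump edge). [folklore] -/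
theorem closed_consistent_iff (ι : LegInsertionData) (V : Finset (ℤ × ℤ)) (hadm : ι.IsAdmissible V)
    (hnp : ∀ x y : ℤ, ((x, y) ∈ V → (x + 1, y + 1) ∈ V → (x + 1, y) ∈ V ∨ (x, y + 1) ∈ V) ∧
      ((x + 1, y) ∈ V → (x, y + 1) ∈ V → (x, y) ∈ V ∨ (x + 1, y + 1) ∈ V))
    {e : (ℤ × ℤ) × Bool} (he : e ∈ (ι.model V).frozenEdges) (hne : e ∉ (ι.model V).openEdges)
    (hh : ↥(ι.model V).freeCells → ℤ) :
    (ι.model V).hf hh (SixVertex.leftFace e true) = (ι.model V).hf hh (SixVertex.leftFace e false) ↔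
      (ι.model V).C.faceH (SixVertex.leftFace e true) =
        (ι.model V).C.faceH (SixVertex.leftFace e false) := by
  rw [closed_hf_eq ι V hadm hnp he hne true hh, closed_hf_eq ι V hadm hnp he hne false hh]

/-! ### Registered one-line form -/

/-- **Sub-goal `s13_frozenConsistency`** (registered on stmt-CriticalPhenomena-14132): Lemma C of
the insertion dictionary D2 — the consistency of frozen turns is configuration-independent. For
every collar model of a leg insertion: both endpoints of a frozen OPEN edge are prescribed
vertex-cells (`hv h = C.vertH` there, every `h`); and, for an ADMISSIBLE insertion on a PINCH-FREE
`V`, every side face of a frozen edge that is NOT open is not a free cell (`hf h = C.faceH` there,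
every `h`). [folklore] -/
theorem s13_frozenConsistency : ∀ (ι : Literature.Probability.LatticeModels.CollarLegModel.LegInsertionData) (V : Finset (ℤ × ℤ)), (∀ e ∈ (Literature.Probability.LatticeModels.CollarLegModel.LegInsertionData.model ι V).openEdges, (e.1, false) ∉ (Literature.Probability.LatticeModels.CollarLegModel.LegInsertionData.model ι V).freeCells ∧ (Literature.Probability.LatticeModels.SixVertex.edgeTip e, false) ∉ (Literature.Probability.LatticeModels.CollarLegModel.LegInsertionData.model ι V).freeCells ∧ ∀ h : ↥(Literature.Probability.LatticeModels.CollarLegModel.LegInsertionData.model ι V).freeCells → ℤ, (Literature.Probability.LatticeModels.CollarLegModel.LegInsertionData.model ι V).hv h e.1 = (Literature.Probability.LatticeModels.CollarLegModel.LegInsertionData.model ι V).C.vertH e.1 ∧ (Literature.Probability.LatticeModels.CollarLegModel.LegInsertionData.model ι V).hv h (Literature.Probability.LatticeModels.SixVertex.edgeTip e) = (Literature.Probability.LatticeModels.CollarLegModel.LegInsertionData.model ι V).C.vertH (Literature.Probability.LatticeModels.SixVertex.edgeTip e)) ∧ (ι.IsAdmissible V → (∀ x y : ℤ, ((x, y)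 ∈ V → (x + 1, y + 1) ∈ V → (x + 1, y) ∈ V ∨ (x, y + 1) ∈ V) ∧ ((x + 1, y) ∈ V → (x, y + 1) ∈ V → (x, y) ∈ V ∨ (x + 1, y + 1) ∈ V)) → ∀ e ∈ (Literature.Probability.LatticeModels.CollarLegModel.LegInsertionData.model ι V).frozenEdges, e ∉ (Literature.Probability.LatticeModels.CollarLegModel.LegInsertionData.model ι V).openEdges → ∀ s : Bool, (Literature.Probability.LatticeModels.SixVertex.leftFace e s, true) ∉ (Literature.Probability.LatticeModels.CollarLegModel.LegInsertionData.model ι V).freeCells ∧ ∀ h : ↥(Literature.Probability.LatticeModels.CollarLegModel.LegInsertionData.model ι V).freeCells → ℤ, (Literature.Probability.LatticeModels.CollarLegModel.LegInsertionData.model ι V).hf h (Literature.Probability.LatticeModels.SixVertex.leftFace e s) = (Literature.Probability.LatticeModels.CollarLegModel.LegInsertionData.model ι V).C.faceH (Literature.Probability.LatticeModels.SixVertex.leftFace e s)) :=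
  fun ι V => ⟨fun _ he => ⟨(openEdges_endpoints_not_free _ he).1, (openEdges_endpoints_not_free _ he).2,
      fun hh => openEdges_hv_eq _ he hh⟩,
    fun hadm hnp _ he hne s => ⟨closed_leftFace_not_free ι V hadm hnp he hne s,
      fun hh => closed_hf_eq ι V hadm hnp he hne s hh⟩⟩

end Summit.CriticalPhenomena.CardyFormulaZ2.Cruxes.BoundaryDefectGaussianR.RainbowMonomialsInExcursionKernels
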